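import Summits.CriticalPhenomena.PercolationContinuityZ3.Theorems.PercNearOneGluingNoHeavyLowerTailSunflowerAntipodalGladkov
import Mathlib.Data.Fintype.Powerset
import HarnessLib

/-!
# `NoHeavyLowerTail` (crux stmt-CriticalPhenomena-4575), abstract sunflower cubic: the DOUBLED STAR — the three-block partition counts
# that refute "Lemma B" of the partition-lemma programme (`N(A,B,B) = 37`, `Σ_{i<j} N(C_i,C_j,B) = 30`, `N(C₁,C₂,C₃) = 8`)

Support file (seat `prim-l12-p2` gen 5; `--supports stmt-CriticalPhenomena-4575`).  Definition-free (the witness sunflower is built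
inline), no named facts, no `sorry`, no `native_decide` (`decide +kernel`).  Memo: run/shared/lean/prim/prim-l12/prim-l12-p2/FINDING-g5-LEMMA-B-FALSE.md.

CONTEXT.  prove-1 g25 (memo run/shared/lean/prim/prim-ineq-prove-1/ABSTRACT-SUNFLOWER-CUBIC-prove1-g25.md §4) reduced `H_{q+t}`, `γ`, `G₄`,
`AG⁺`, `T_inc`, `3PT-LB` to the PARTITION LEMMA ★ for monotone maps `2^E → M₃` (`Sunflower`, companion file), split ★ = (a) + "Lemma B"
with (a) proved (`Sunflower.antipodal_gladkov` summed over a kernel spectator) and LEMMA B — `N(A,B,B) − Σ_{i<j} N(C_i,C_j,B) ≥ N(C₁,C₂,C₃)`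
for the counts `N(X,Y,Z)` of ordered 3-partitions `(P¹,P²,P³)` of the ground set with `P¹ ∈ X, P² ∈ Y, P³ ∈ Z` — as the open core
(census-clean for all maps on `≤ 5` coordinates).

THIS FILE: Lemma B fails on SIX coordinates.  Witness = the percolation three-point sunflower of the star `K_{1,3}` with every edge
cloned twice (ground set `Fin 6`, clone group `k = {2k, 2k+1}`): `V i` = sets hitting both clone groups other than `i`, kernel = sets
hitting all three groups, bottom = sets hitting at most one group.  With ordered 3-partitions encoded as disjoint pairs `(P¹,P²)`,
`P³ = (P¹ ∪ P²)ᶜ` (as in prove-1's `parts`):  `N(A,B,B) = 37`, `Σ_{i<j} N(C_i,C_j,B) = 30`, `N(C₁,C₂,C₃) = 8`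
(`exists_doubledStar_counts`), so the Lemma-B slack is `37 − 30 − 8 = −1 < 0`; ★ itself holds there (`N(A,A,B) = 8`,
`Σ N(C_i,C_j,A) = 0`: `8 + 37 − 0 − 30 − 8 = 7 ≥ 0`).  Law-level reason: the Lemma-B kernel polarises `Hb = q·AG − e₃`, which is negative
on stars with `t > q`; the corrected shape of ★ is `N(C₁,C₂,C₃) ≤ [N(A,A,B) − Σ N(C_i,C_j,A)] + [N(A,B,B) − Σ N(C_i,C_j,B)]`.
-/

namespace Summit.CriticalPhenomena.PercolationContinuityZ3.Theorems.SunflowerPartition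

open Finset

set_option maxHeartbeats 2000000 in
/-- **The doubled star: partition counts refuting Lemma B.**  There is a sunflower on `Fin 6` (the three-point sunflower of the star
`K_{1,3}` with doubled edges) whose ordered 3-partitions `(P¹, P², P³ = (P¹ ∪ P²)ᶜ)` have
`N(A,B,B) = 37` (kernel, bottom, bottom), `Σ_{i<j} N(C_i,C_j,B) = 30` (two distinct petals in increasing label order, then bottom),
`N(C₁,C₂,C₃) = 8` (the three petals in label order) and `N(A,A,B) = 8`, `Σ_{i<j} N(C_i,C_j,A) = 0`; hence
`N(A,B,B) − Σ N(C_i,C_j,B) − N(C₁,C₂,C₃) = −1 < 0` (Lemma B fails) while the partition lemma's total `8 + 37 − 0 − 30 − 8 = 7` is `≥ 0`. [this work] -/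
theorem exists_doubledStar_counts : ∃ F : Sunflower (Fin 6),
    ((univ : Finset (Finset (Fin 6) × Finset (Fin 6))).filter fun q =>
        Disjoint q.1 q.2 ∧ F.lab q.1 = 4 ∧ F.lab q.2 = 0 ∧ F.lab (q.1 ∪ q.2)ᶜ = 0).card = 37 ∧
    ((univ : Finset (Finset (Fin 6) × Finset (Fin 6))).filter fun q =>
        Disjoint q.1 q.2 ∧ F.lab q.1 ≠ 0 ∧ F.lab q.1 ≠ 4 ∧ F.lab q.2 ≠ 0 ∧ F.lab q.2 ≠ 4 ∧ F.lab q.1 < F.lab q.2 ∧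
          F.lab (q.1 ∪ q.2)ᶜ = 0).card = 30 ∧
    ((univ : Finset (Finset (Fin 6) × Finset (Fin 6))).filter fun q =>
        Disjoint q.1 q.2 ∧ F.lab q.1 = 1 ∧ F.lab q.2 = 2 ∧ F.lab (q.1 ∪ q.2)ᶜ = 3).card = 8 ∧
    ((univ : Finset (Finset (Fin 6) × Finset (Fin 6))).filter fun q =>
        Disjoint q.1 q.2 ∧ F.lab q.1 = 4 ∧ F.lab q.2 = 4 ∧ F.lab (q.1 ∪ q.2)ᶜ = 0).card = 8 ∧
    ((univ : Finset (Finset (Fin 6) × Finset (Fin 6))).filter fun q =>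
        Disjoint q.1 q.2 ∧ F.lab q.1 ≠ 0 ∧ F.lab q.1 ≠ 4 ∧ F.lab q.2 ≠ 0 ∧ F.lab q.2 ≠ 4 ∧ F.lab q.1 < F.lab q.2 ∧
          F.lab (q.1 ∪ q.2)ᶜ = 4).card = 0 := by
  refine ⟨⟨fun i => Finset.univ.filter fun S => ∀ k : Fin 3, k ≠ i → ∃ x ∈ S, x.val / 2 = k.val, ?_, ?_⟩, ?_⟩
  · intro i S T hST hS
    simp only [Finset.coe_filter, Finset.mem_univ, true_and, Set.mem_setOf_eq] at hS ⊢
    intro k hk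
    obtain ⟨x, hx, hxk⟩ := hS k hk
    exact ⟨x, hST hx, hxk⟩
  · intro i j hij
    ext S
    simp only [Finset.mem_inter, Finset.mem_filter, Finset.mem_univ, true_and]
    constructor
    · rintro ⟨hi, hj⟩
      have hall : ∀ k : Fin 3, ∃ x ∈ S, x.val / 2 = k.val := fun k => by
        by_cases hki : k = i
        · subst hki; exact hj k hij
        · exact hi k hki
      exact ⟨fun k _ => hall k, fun k _ => hall k⟩
    · rintro ⟨h0, h1⟩
      have hall : ∀ k : Fin 3, ∃ x ∈ S, x.val / 2 = k.val := fun k => by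
        by_cases hk0 : k = 0
        · subst hk0; exact h1 0 (by decide)
        · exact h0 k hk0
      exact ⟨fun k _ => hall k, fun k _ => hall k⟩
  · refine ⟨?_, ?_, ?_, ?_, ?_⟩ <;> decide +kernel

end Summit.CriticalPhenomena.PercolationContinuityZ3.Theorems.SunflowerPartition
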